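import Mathlib
import HarnessLib

/-!
# Route FreeSubtorus — crux `OrbitDimensionBound` (stmt-ValiantsHypothesis-16133), line `affine_multiple`,
# stub 2 `stub_absorbingSacrifice`, open core (3a)(ii): RIGID CONFIGURATION ⇒ CONSTANT `j₀`-COEFFICIENTS

Registered line `Cruxes/OrbitDimensionBound/Lines/affine_multiple.lean`; this file serves its load-bearing stub 2
(branch (c) of the card, l.120–127) and renders in the kernel the sentence

  «… is either re-matched (`M − (ι_j,κ_j) + (ι_j,l)`, or `M − (ι_j,κ_j) + (k'',l'') + (ι_j,l)`, spanning iff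
  `[a_{ι_j}] ≠ [b_l]` resp. `[a_{k''}] ≠ [b_{l''}]` in `W / span(M ∖ j) ≅ ℚ`), or — when all of these fail, which forces
  `[a_k] = [b_{l'}] = [b_{κ_j}] = [b_l] − 1` for all free `k, l' ≠ l` — …»

in the floor's indexing after `stub_relabel` (free rows/columns = `Fin.castAdd s ·`, sacrificed pair `j` =
(`Fin.natAdd n' j`, `Fin.natAdd n' j`)) and in the currency of `torusExtension_explicit` (p581884): the matched
differences `D j = Λ(·)(inl ι_j) − Λ(·)(inr κ_j)` (linearly independent over `ℚ` — the matching is a maximum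
INDEPENDENT one), and the integer coefficients `ar k j`, `ac l j` of `N·a_k`, `N·b_l` in the `D j`.

* `rigid_coefficients_abstract` — the linear algebra over any `ℚ`-vector space: if the re-matchings at
  `(ι_{j₀}, l₀)` all fail — (R1) `a_{ι_{j₀}} − b_{l₀}`, (R2) `a_k − b_l` (`k` free, `l ≠ l₀` free) and (R3) `a_k − b_{κ_{j₀}}`
  (`k` free) all lie in the span of the OTHER differences `D j`, `j ≠ j₀` (written out: a `ℚ`-combination with zero
  `j₀`-coefficient) — then the `j₀`-coefficients are constant: `ar k j₀ = α` for every free `k`, `ac l j₀ = α` for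
  every free `l ≠ l₀`, and `ac l₀ j₀ = α + N` (the class computation `[a_k] = [b_{l'}] = [b_{κ_{j₀}}] = [b_{l₀}] − 1`,
  scaled by `N`; `[D_{j₀}] = [a_{ι_{j₀}}] − [b_{κ_{j₀}}] = 1`).
* `rigid_coefficients` — the same for the lattice datum `Λ : Fin r → (Fin (n'+s) ⊕ Fin (n'+s)) → ℤ` with `har`/`hac`
  literally the hypotheses of `torusExtension_explicit`.

With it the character condition of the pinned extension (`torusExtension_pin_sacRow_freeCol`: `e'_{l₀}^N = A_{j₀}`)
reads `(∏ d' ∏ e')^α = 1`, i.e. the extension set contains the per-invariant torus `T¹ = torusGen n' 1 𝟙`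
(`exists_roots_prod_eq_one`).  What remains of stub 2 after this file: (3a)(i), the CASE SPLIT with the re-matchings
(card branches (a)/(b)/(c)), i.e. producing `hrigid` or a larger matching.

Honest framing: a helper INSIDE a registered stub's proof on a conditional route; `stub_absorbingSacrifice`, the crux
`OrbitDimensionBound` and VP ≠ VNP are NOT proved; census-neutral.  No definitions, no named facts.
-/

set_option linter.dupNamespace false

noncomputable section

open scoped BigOperators

namespace Summit.ValiantsHypothesis.ValiantsHypothesis.Theorems.FreeSubtorusOrbitDimensionBound.AbsorbingSacrifice

/-! ### Coordinates along an independent family -/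

/-- Uniqueness of coordinates along a linearly independent finite family. [folklore] -/
theorem coords_unique {V : Type*} [AddCommGroup V] [Module ℚ V] {s : ℕ} {D : Fin s → V}
    (hw : LinearIndependent ℚ D) {g g' : Fin s → ℚ} (h : ∑ j, g j • D j = ∑ j, g' j • D j) : g = g' := by
  have h0 : ∑ j, (g j - g' j) • D j = 0 := by
    simp only [sub_smul, Finset.sum_sub_distrib, h, sub_self]
  funext j
  have := Fintype.linearIndependent_iff.1 hw (fun j => g j - g' j) h0 j
  exact sub_eq_zero.1 this

/-- **The `j₀`-coordinate computation.** If `N·x = Σ α_j D_j`, `N·y = Σ β_j D_j` and `x − y + t·D_{j₀}` is a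
combination of the `D_j` with zero `j₀`-coefficient, then `α_{j₀} − β_{j₀} + N t = 0`. [folklore] -/
theorem coord_relation {V : Type*} [AddCommGroup V] [Module ℚ V] {s : ℕ} {D : Fin s → V}
    (hw : LinearIndependent ℚ D) (j₀ : Fin s) (N : ℚ) {x y : V} {α β c : Fin s → ℚ} {t : ℚ}
    (hx : N • x = ∑ j, α j • D j) (hy : N • y = ∑ j, β j • D j) (hc : c j₀ = 0)
    (h : x - y + t • D j₀ = ∑ j, c j • D j) : α j₀ - β j₀ + N * t = 0 := by
  classical
  -- `N (x - y + t D_{j₀}) = Σ (α - β + N t δ_{j₀}) D = Σ N c D`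
  have h1 : ∑ j, (α j - β j + (if j = j₀ then N * t else 0)) • D j = ∑ j, (N * c j) • D j := by
    have hL : ∑ j, (α j - β j + (if j = j₀ then N * t else 0)) • D j = N • (x - y + t • D j₀) := by
      simp only [add_smul, sub_smul, Finset.sum_add_distrib, Finset.sum_sub_distrib, ← hx, ← hy, ite_smul,
        zero_smul, Finset.sum_ite_eq', Finset.mem_univ, if_true, smul_sub, smul_add, smul_smul]
    rw [hL, h, Finset.smul_sum]
    simp only [smul_smul]
  have h2 := congrFun (coords_unique hw h1) j₀
  simp only [if_true] at h2
  rw [hc, mul_zero] at h2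
  linarith

/-! ### The abstract rigidity lemma -/

/-- **Rigid configuration ⇒ constant `j₀`-coefficients (abstract form).**  `D : Fin s → V` linearly independent
(the matched differences), `D j₀ = A₀ − B₀` (row and column vector of the pair `j₀`), free row vectors `a k` and free
column vectors `b l` with `N·a_k = Σ_j ar k j · D_j`, `N·b_l = Σ_j ac l j · D_j`.  If all re-matchings at
`(ι_{j₀}, l₀)` fail — (R1) `A₀ − b_{l₀}`, (R2) every `a_k − b_l` with `l ≠ l₀`, (R3) every `a_k − B₀` lie in the span of
`{D_j : j ≠ j₀}` (a combination with zero `j₀`-coefficient) — then for some integer `α`: `ar k j₀ = α` for all `k`,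
`ac l j₀ = α` for all `l ≠ l₀`, and `ac l₀ j₀ = α + N`. [folklore] -/
theorem rigid_coefficients_abstract {V : Type*} [AddCommGroup V] [Module ℚ V] {s n' : ℕ}
    (D : Fin s → V) (hw : LinearIndependent ℚ D) (a b : Fin n' → V) (A₀ B₀ : V) (j₀ : Fin s)
    (hD₀ : D j₀ = A₀ - B₀) (N : ℕ) (ar ac : Fin n' → Fin s → ℤ)
    (har : ∀ k, (N : ℚ) • a k = ∑ j, (ar k j : ℚ) • D j)
    (hac : ∀ l, (N : ℚ) • b l = ∑ j, (ac l j : ℚ) • D j) (l₀ : Fin n')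
    (hR1 : ∃ c : Fin s → ℚ, c j₀ = 0 ∧ A₀ - b l₀ = ∑ j, c j • D j)
    (hR2 : ∀ k l, l ≠ l₀ → ∃ c : Fin s → ℚ, c j₀ = 0 ∧ a k - b l = ∑ j, c j • D j)
    (hR3 : ∀ k, ∃ c : Fin s → ℚ, c j₀ = 0 ∧ a k - B₀ = ∑ j, c j • D j) :
    ∃ α : ℤ, (∀ k, ar k j₀ = α) ∧ (∀ l, l ≠ l₀ → ac l j₀ = α) ∧ ac l₀ j₀ = α + N := by
  classical
  -- a reference free row: `k₀ := l₀` (rows and columns are both indexed by `Fin n'`)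
  set k₀ : Fin n' := l₀ with hk₀
  refine ⟨ar k₀ j₀, fun k => ?_, fun l hl => ?_, ?_⟩
  · -- (R3) for `k` and `k₀`: `a_k − a_{k₀}` has zero `j₀`-coordinate
    obtain ⟨c, hc, hck⟩ := hR3 k
    obtain ⟨c', hc', hck'⟩ := hR3 k₀
    have h : a k - a k₀ + (0 : ℚ) • D j₀ = ∑ j, (c j - c' j) • D j := by
      rw [zero_smul, add_zero]
      have : a k - a k₀ = (a k - B₀) - (a k₀ - B₀) := by abel
      rw [this, hck, hck', ← Finset.sum_sub_distrib]
      simp only [sub_smul]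
    have := coord_relation hw j₀ (N : ℚ) (har k) (har k₀) (by simp [hc, hc']) h
    have : ((ar k j₀ : ℤ) : ℚ) = ((ar k₀ j₀ : ℤ) : ℚ) := by linarith
    exact_mod_cast this
  · -- (R2) for `(k₀, l)`: `a_{k₀} − b_l` has zero `j₀`-coordinate
    obtain ⟨c, hc, hcl⟩ := hR2 k₀ l hl
    have h : a k₀ - b l + (0 : ℚ) • D j₀ = ∑ j, c j • D j := by rw [zero_smul, add_zero, hcl]
    have := coord_relation hw j₀ (N : ℚ) (har k₀) (hac l) hc h
    have : ((ac l j₀ : ℤ) : ℚ) = ((ar k₀ j₀ : ℤ) : ℚ) := by linarith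
    exact_mod_cast this
  · -- (R1) + (R3) for `k₀`: `a_{k₀} − b_{l₀} + D_{j₀}` has zero `j₀`-coordinate
    obtain ⟨c, hc, hcl⟩ := hR1
    obtain ⟨c', hc', hck⟩ := hR3 k₀
    have h : a k₀ - b l₀ + (1 : ℚ) • D j₀ = ∑ j, (c j + c' j) • D j := by
      rw [one_smul]
      have : a k₀ - b l₀ + D j₀ = (A₀ - b l₀) + (a k₀ - B₀) := by rw [hD₀]; abel
      rw [this, hcl, hck, ← Finset.sum_add_distrib]
      simp only [add_smul]
    have := coord_relation hw j₀ (N : ℚ) (har k₀) (hac l₀) (by simp [hc, hc']) h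
    have : ((ac l₀ j₀ : ℤ) : ℚ) = ((ar k₀ j₀ : ℤ) : ℚ) + (N : ℚ) := by linarith
    exact_mod_cast this

/-- Membership in the span of the OTHER differences, written out: a `ℚ`-combination with zero `j₀`-coefficient.
[folklore] -/
theorem exists_coeffs_of_mem_span_ne {V : Type*} [AddCommGroup V] [Module ℚ V] {s : ℕ} (D : Fin s → V)
    (j₀ : Fin s) {x : V} (hx : x ∈ Submodule.span ℚ (D '' {j | j ≠ j₀})) :
    ∃ c : Fin s → ℚ, c j₀ = 0 ∧ x = ∑ j, c j • D j := by
  classical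
  rw [Finsupp.mem_span_image_iff_linearCombination] at hx
  obtain ⟨l, hl, rfl⟩ := hx
  refine ⟨l, ?_, ?_⟩
  · by_contra h
    have : j₀ ∈ l.support := Finsupp.mem_support_iff.2 h
    exact (hl this) rfl
  · rw [Finsupp.linearCombination_apply, Finsupp.sum_fintype _ _ (fun j => zero_smul ℚ (D j))]

/-- **Rigid configuration ⇒ constant `j₀`-coefficients**, with the three failures stated as MEMBERSHIP IN THE SPAN of
the other matched differences (`Submodule.span ℚ (D '' {j | j ≠ j₀})`). [folklore] -/
theorem rigid_coefficients_of_mem_span {V : Type*} [AddCommGroup V] [Module ℚ V] {s n' : ℕ}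
    (D : Fin s → V) (hw : LinearIndependent ℚ D) (a b : Fin n' → V) (A₀ B₀ : V) (j₀ : Fin s)
    (hD₀ : D j₀ = A₀ - B₀) (N : ℕ) (ar ac : Fin n' → Fin s → ℤ)
    (har : ∀ k, (N : ℚ) • a k = ∑ j, (ar k j : ℚ) • D j)
    (hac : ∀ l, (N : ℚ) • b l = ∑ j, (ac l j : ℚ) • D j) (l₀ : Fin n')
    (hR1 : A₀ - b l₀ ∈ Submodule.span ℚ (D '' {j | j ≠ j₀}))
    (hR2 : ∀ k l, l ≠ l₀ → a k - b l ∈ Submodule.span ℚ (D '' {j | j ≠ j₀}))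
    (hR3 : ∀ k, a k - B₀ ∈ Submodule.span ℚ (D '' {j | j ≠ j₀})) :
    ∃ α : ℤ, (∀ k, ar k j₀ = α) ∧ (∀ l, l ≠ l₀ → ac l j₀ = α) ∧ ac l₀ j₀ = α + N :=
  rigid_coefficients_abstract D hw a b A₀ B₀ j₀ hD₀ N ar ac har hac l₀
    (exists_coeffs_of_mem_span_ne D j₀ hR1) (fun k l hl => exists_coeffs_of_mem_span_ne D j₀ (hR2 k l hl))
    (fun k => exists_coeffs_of_mem_span_ne D j₀ (hR3 k))

/-! ### The lattice form (currency of `torusExtension_explicit`) -/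

/-- **Rigid configuration ⇒ constant `j₀`-coefficients**, for the admissible lattice datum `Λ` of the line
`affine_multiple` after relabelling (free rows/columns `Fin.castAdd s ·`, sacrificed pairs `(Fin.natAdd n' j,
Fin.natAdd n' j)`), with `har`/`hac` VERBATIM the hypotheses of `torusExtension_explicit` and the matched differences
linearly independent over `ℚ` (maximum INDEPENDENT matching).  `hrigid` = failure of all re-matchings at
`(natAdd j₀, castAdd l₀)`: (R1) the difference `Λ(inl natAdd j₀) − Λ(inr castAdd l₀)`, (R2) every `Λ(inl castAdd k) −
Λ(inr castAdd l)` with `l ≠ l₀`, (R3) every `Λ(inl castAdd k) − Λ(inr natAdd j₀)` is a `ℚ`-combination of the other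
matched differences (zero `j₀`-coefficient).  Conclusion: `ar k j₀ = α` (all free `k`), `ac l j₀ = α` (free `l ≠ l₀`),
`ac l₀ j₀ = α + N` — so the pinned character reads `(∏ d' ∏ e')^α = 1`. [folklore] -/
theorem rigid_coefficients (n' s r : ℕ) (Λ : Fin r → (Fin (n' + s) ⊕ Fin (n' + s)) → ℤ) (N : ℕ)
    (ar ac : Fin n' → Fin s → ℤ)
    (har : ∀ k i, (N : ℤ) * Λ i (Sum.inl (Fin.castAdd s k)) =
      ∑ j, ar k j * (Λ i (Sum.inl (Fin.natAdd n' j)) - Λ i (Sum.inr (Fin.natAdd n' j))))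
    (hac : ∀ l i, (N : ℤ) * Λ i (Sum.inr (Fin.castAdd s l)) =
      ∑ j, ac l j * (Λ i (Sum.inl (Fin.natAdd n' j)) - Λ i (Sum.inr (Fin.natAdd n' j))))
    (hw : LinearIndependent ℚ (fun (j : Fin s) (i : Fin r) =>
      ((Λ i (Sum.inl (Fin.natAdd n' j)) : ℚ) - (Λ i (Sum.inr (Fin.natAdd n' j)) : ℚ))))
    (j₀ : Fin s) (l₀ : Fin n')
    (hrigid :
      (∃ c : Fin s → ℚ, c j₀ = 0 ∧ ∀ i,
        ((Λ i (Sum.inl (Fin.natAdd n' j₀)) : ℚ) - (Λ i (Sum.inr (Fin.castAdd s l₀)) : ℚ)) =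
          ∑ j, c j * (((Λ i (Sum.inl (Fin.natAdd n' j)) : ℚ) - (Λ i (Sum.inr (Fin.natAdd n' j)) : ℚ)))) ∧
      (∀ k l, l ≠ l₀ → ∃ c : Fin s → ℚ, c j₀ = 0 ∧ ∀ i,
        ((Λ i (Sum.inl (Fin.castAdd s k)) : ℚ) - (Λ i (Sum.inr (Fin.castAdd s l)) : ℚ)) =
          ∑ j, c j * (((Λ i (Sum.inl (Fin.natAdd n' j)) : ℚ) - (Λ i (Sum.inr (Fin.natAdd n' j)) : ℚ)))) ∧
      (∀ k, ∃ c : Fin s → ℚ, c j₀ = 0 ∧ ∀ i,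
        ((Λ i (Sum.inl (Fin.castAdd s k)) : ℚ) - (Λ i (Sum.inr (Fin.natAdd n' j₀)) : ℚ)) =
          ∑ j, c j * (((Λ i (Sum.inl (Fin.natAdd n' j)) : ℚ) - (Λ i (Sum.inr (Fin.natAdd n' j)) : ℚ))))) :
    ∃ α : ℤ, (∀ k, ar k j₀ = α) ∧ (∀ l, l ≠ l₀ → ac l j₀ = α) ∧ ac l₀ j₀ = α + N := by
  classical
  -- the vectors over `ℚ`
  set D : Fin s → (Fin r → ℚ) := fun j i =>
    ((Λ i (Sum.inl (Fin.natAdd n' j)) : ℚ) - (Λ i (Sum.inr (Fin.natAdd n' j)) : ℚ)) with hDdef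
  set a : Fin n' → (Fin r → ℚ) := fun k i => ((Λ i (Sum.inl (Fin.castAdd s k)) : ℚ)) with hadef
  set b : Fin n' → (Fin r → ℚ) := fun l i => ((Λ i (Sum.inr (Fin.castAdd s l)) : ℚ)) with hbdef
  set A₀ : Fin r → ℚ := fun i => ((Λ i (Sum.inl (Fin.natAdd n' j₀)) : ℚ)) with hA₀
  set B₀ : Fin r → ℚ := fun i => ((Λ i (Sum.inr (Fin.natAdd n' j₀)) : ℚ)) with hB₀
  -- pointwise form of a combination `Σ c_j • D_j`
  have hsum : ∀ (c : Fin s → ℚ) (i : Fin r), (∑ j, c j • D j) i =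
      ∑ j, c j * (((Λ i (Sum.inl (Fin.natAdd n' j)) : ℚ) - (Λ i (Sum.inr (Fin.natAdd n' j)) : ℚ))) := by
    intro c i
    rw [Finset.sum_apply]
    rfl
  have har' : ∀ k, (N : ℚ) • a k = ∑ j, (ar k j : ℚ) • D j := by
    intro k; funext i
    rw [hsum, Pi.smul_apply, smul_eq_mul]
    have := har k i
    have h' : ((N : ℤ) : ℚ) * (Λ i (Sum.inl (Fin.castAdd s k)) : ℚ) =
        ∑ j, (ar k j : ℚ) * (((Λ i (Sum.inl (Fin.natAdd n' j)) : ℚ) - (Λ i (Sum.inr (Fin.natAdd n' j)) : ℚ))) := by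
      exact_mod_cast this
    simpa using h'
  have hac' : ∀ l, (N : ℚ) • b l = ∑ j, (ac l j : ℚ) • D j := by
    intro l; funext i
    rw [hsum, Pi.smul_apply, smul_eq_mul]
    have := hac l i
    have h' : ((N : ℤ) : ℚ) * (Λ i (Sum.inr (Fin.castAdd s l)) : ℚ) =
        ∑ j, (ac l j : ℚ) * (((Λ i (Sum.inl (Fin.natAdd n' j)) : ℚ) - (Λ i (Sum.inr (Fin.natAdd n' j)) : ℚ))) := by
      exact_mod_cast this
    simpa using h'
  obtain ⟨⟨c₁, hc₁, h₁⟩, h₂, h₃⟩ := hrigid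
  refine rigid_coefficients_abstract D hw a b A₀ B₀ j₀ rfl N ar ac har' hac' l₀
    ⟨c₁, hc₁, funext fun i => by rw [hsum]; exact h₁ i⟩ (fun k l hl => ?_) (fun k => ?_)
  · obtain ⟨c, hc, h⟩ := h₂ k l hl
    exact ⟨c, hc, funext fun i => by rw [hsum]; exact h i⟩
  · obtain ⟨c, hc, h⟩ := h₃ k
    exact ⟨c, hc, funext fun i => by rw [hsum]; exact h i⟩

end Summit.ValiantsHypothesis.ValiantsHypothesis.Theorems.FreeSubtorusOrbitDimensionBound.AbsorbingSacrifice

end
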